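import Summits.QuantumFields.YangMills.Theorems.BalabanLadderNTBoundaryLawOscillation
import Summits.QuantumFields.YangMills.Theorems.OneCertifiedCubeFiniteSizeCriterion
import Summits.QuantumFields.YangMills.Theorems.ConvexGribovBodyNonSimplyConnectedLatticeGapStubCellFiniteSizeSmallBeta
import Summits.QuantumFields.YangMills.Theorems.ConvexGribovBodyNonSimplyConnectedLatticeGapStubInfluenceAntitone
import Summits.QuantumFields.YangMills.Theorems.LangevinControlUVOSLegsFromFemtoAndGapStubLowerAux
import HarnessLib

/-!
# Crux `NT` (stmt-QuantumFields-19353) / seam `UVSeamRec` (stmt-QuantumFields-20043): the ∀-exterior one-point law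
# (E1-osc = `RefPkgT` clause 1; BL6-osc, `FBL6 ⇔ E1-osc`) HOLDS AT STRONG COUPLING — format rung, explicit constants

Helper file of the fleet lead prover of crux `NT` (unit `ym-spine-19353-p1`, g6).  The registered stub `stub_refpkgT : RefPkgT`
(skeleton v4T, 4297522f58b4) opens with the exterior-OSCILLATION ceiling of the one-point kernel means of the action density,

  (E1-osc)  `|kerE_{Q,η}(dens x) − kerE_{Q,η'}(dens x)| ≤ C₁ / depth_Q(x)⁴`  for every femto cube `Q = (c, b)`, ALL exteriors
            `η, η'`, every site `x` of depth `≥ 1`,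

the ∀-exterior one-point law both stubs of the seam `UVSeamRec` consume as well (`stub_ceilings` through `FBL6 ⇔ E1-osc`,
`stub_floorsEngine` through every landed floors currency).  Every file of this crux so far ASSUMES it.  This file PROVES its
body in the one regime the tree can decide — strong coupling `|β| < β₁(G, r)` — for EVERY cube (no femto restriction), every
pair of exteriors and every site, with explicit constants and in fact EXPONENTIAL decay in the depth:

* `osc_kerE_centred_le_of_cellFS` — engine core: under the Dobrushin–Shlosman total-variation finite-size condition at window
  `n = 1`, cell size `b = 1`, threshold `ε` (hypothesis `hFS`, verbatim the tree's `FiniteSizeCriterion.box_influence_le` at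
  `b = n = 1`), for a bounded measurable cylinder observable `A` read within sup-radius `R_A` of the origin, the kernel means of
  `A` in the CENTRED cube `[-R, R]⁴` under ANY two exteriors differ by `≤ 2‖A‖ (2R_A+1)⁴ (1776 ε)^k` whenever
  `R_A + 3k + 1 ≤ R` (block recursion on the Dobrushin–Shlosman box of radius `R_A + 3k`, which lies inside the cube; then
  antitonicity of the oscillation in the volume, `stub_influence_antitone`);
* `osc_kerE_centred_le_smallBeta` — ONE `β₁ = β₁(G, r) > 0` (`stub_cellFiniteSize_smallBeta` at threshold `1/14208`, ratio
  `1776 ε = 1/8`) such that for `|β| < β₁`, EVERY such `A`, every radius `R` and all exteriors: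
  `≤ 2‖A‖ (2R_A+1)⁴ · 8^{−⌊(R−R_A−1)/3⌋}`;
* `osc_kerE_le_of_centred_family` — transport to every cube for a translation-covariant family of local fields (centred
  sub-cube of radius `depth − 1`, `abs_kerE_sub_kerE_le_of_subset`; the geometric-to-exponential conversion `eighth_pow_le`);
* `osc_kerE_dens_le_smallBeta` — **E1-osc, exponential form**: `|β| < β₁` ⇒ for EVERY cube `(c, b)`, all `η, η'`, every `x`,
  `|kerE_{(c,b),η}(dens x) − kerE_{(c,b),η'}(dens x)| ≤ 5184 · M · 2^{−depth}` (`M` any sup bound of the action density);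
* `e1osc_smallBeta` — **E1-osc in the REGISTERED shape** (`RefPkgT` clause 1 with `β₁ ≤ β` replaced by `|β| < β₁`, no femto
  restriction): `… ≤ C₁ / depth⁴`, `C₁ = 124416 · M / (log 2)⁴` (`2^{−d} ≤ 24 / ((log 2)⁴ d⁴)` from `x⁴/4! ≤ eˣ`);
* `osc_kerE_plane_le_smallBeta`, `bl6osc_smallBeta` — the same two statements for the single-plane fields `plane G r q x`
  (the `FBL6`/BL6 object of `stub_fcp6` and of the seam's ceilings), same constants with `M₆ = sup |plane|`.

HONEST FRAMING.  A format rung: the clause's SHAPE (uniform in the cube, the site and BOTH exteriors; `d⁻⁴` or better) is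
inhabited by the actual lattice Yang–Mills kernels `ymSpecification r.ρ β` in the high-temperature regime, for every compact
metrisable `G` and every lattice representation `r`.  It says NOTHING about `β → ∞`, where the ∀-exterior law is the open (and,
per the 20043 lead's evidence #50, SUSPECT) engine content; nothing about NT, the seam, or the gap.

References: R. L. Dobrushin, S. B. Shlosman (1985) §2; F. Martinelli, LNM 1717 (1999) §2.3; H.-O. Georgii, *Gibbs Measures and
Phase Transitions* (2011) Def. 1.23 (iii), §8.1; K. Osterwalder, E. Seiler, Ann. Phys. 110 (1978) §4 (strong coupling).
-/

set_option autoImplicit false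

noncomputable section

open MeasureTheory Filter Topology
open Literature.MathematicalPhysics.QuantumFieldTheory Literature.MathematicalPhysics.QuantumLattice
open Literature.Probability.LatticeModels
open Summit.QuantumFields.YangMills.Cruxes.OSLegsFromFemtoAndGap.DlrCollarTransfer
open Summit.QuantumFields.YangMills.Theorems (FiniteSizeCriterion.box_influence_le FiniteSizeCriterion.mem_cellBox_iff)
open Summit.QuantumFields.YangMills.Theorems.NonSimplyConnectedLatticeGap
  (stub_cellFiniteSize_smallBeta stub_influence_antitone)
open Summit.QuantumFields.YangMills.Theorems.OSLegsFromFemtoAndGap.StubLower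
  (isCylinder_curvature_shift curvature_shift_supp_window)

namespace Summit.QuantumFields.YangMills.Cruxes.NT.BoundaryLaw

/-! ## §1 Arithmetic: the threshold ratio, geometric-to-exponential and exponential-to-quartic conversions -/

/-- The Dobrushin–Shlosman shell count at window `n = 1` in `d = 4` is `M(1) = 7⁴ − 5⁴ = 1776`; the threshold `ε = 1/14208`
makes the recursion ratio `ε · M(1) = 1/8`. [folklore] -/
theorem dsRatio_eq : (1 / 14208 : ℝ) * (((2 * (2 * 1 + 1) + 1) ^ 4 - (2 * (2 * 1) + 1) ^ 4 : ℕ) : ℝ) = 1 / 8 := by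
  norm_num

/-- `8^{−⌊(d − R_A − 2)/3⌋} ≤ 2^{R_A + 4} · 2^{−d}` for all naturals `d, R_A`. [folklore] -/
theorem eighth_pow_le (RA d : ℕ) : (1 / 8 : ℝ) ^ ((d - RA - 2) / 3) ≤ 2 ^ (RA + 4) * (1 / 2) ^ d := by
  set k : ℕ := (d - RA - 2) / 3 with hk
  have hd : d ≤ 3 * k + (RA + 4) := by omega
  have h8 : (1 / 8 : ℝ) ^ k = (1 / 2) ^ (3 * k) := by rw [pow_mul]; norm_num
  rw [h8]
  have hmono : (1 / 2 : ℝ) ^ (3 * k + (RA + 4)) ≤ (1 / 2) ^ d := pow_le_pow_of_le_one (by norm_num) (by norm_num) hd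
  have h5 : (2 : ℝ) ^ (RA + 4) * (1 / 2 : ℝ) ^ (3 * k + (RA + 4)) = (1 / 2) ^ (3 * k) := by
    rw [pow_add (1 / 2 : ℝ) (3 * k) (RA + 4), mul_left_comm, ← mul_pow]; norm_num
  calc (1 / 2 : ℝ) ^ (3 * k) = 2 ^ (RA + 4) * (1 / 2 : ℝ) ^ (3 * k + (RA + 4)) := h5.symm
    _ ≤ 2 ^ (RA + 4) * (1 / 2) ^ d := mul_le_mul_of_nonneg_left hmono (by positivity)

/-- `2^{−d} ≤ 24 / ((log 2)⁴ d⁴)` for `d ≥ 1` (from `x⁴/4! ≤ eˣ` at `x = d log 2`). [folklore] -/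
theorem half_pow_le_div_pow_four {d : ℕ} (hd : 1 ≤ d) :
    (1 / 2 : ℝ) ^ d ≤ 24 / (Real.log 2 ^ 4 * (d : ℝ) ^ 4) := by
  have hlog : 0 < Real.log 2 := Real.log_pos (by norm_num)
  have hdpos : (0 : ℝ) < d := by exact_mod_cast hd
  have hx : 0 ≤ (d : ℝ) * Real.log 2 := by positivity
  have h := Real.pow_div_factorial_le_exp _ hx 4
  have hfac : ((Nat.factorial 4 : ℕ) : ℝ) = 24 := by norm_num [Nat.factorial]
  have hexp : Real.exp ((d : ℝ) * Real.log 2) = 2 ^ d := by rw [Real.exp_nat_mul, Real.exp_log (by norm_num)]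
  have h2 : ((d : ℝ) * Real.log 2) ^ 4 = Real.log 2 ^ 4 * (d : ℝ) ^ 4 := by ring
  rw [hfac, hexp, h2] at h
  have hpos : (0 : ℝ) < Real.log 2 ^ 4 * (d : ℝ) ^ 4 := by positivity
  have h2d : (0 : ℝ) < 2 ^ d := by positivity
  rw [le_div_iff₀ hpos, one_div_pow, one_div_mul_eq_div, div_le_iff₀ h2d]
  rw [div_le_iff₀ (by norm_num : (0 : ℝ) < 24)] at h
  linarith

/-! ## §2 Geometry: the Dobrushin–Shlosman box inside the centred cube -/

/-- The Dobrushin–Shlosman box of cells of radius `L'` at cell size `1` — the sites `[-L', L']⁴` with ALL their positive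
links — lies inside the interior links `cubeEdges (−R) (2R+1)` of the centred cube `[-R, R]⁴` once `L' + 1 ≤ R`. [folklore] -/
theorem dsBox_subset_cubeEdges_centred {L' R : ℕ} (h : L' + 1 ≤ R) :
    (Fintype.piFinset fun _ : Fin 4 => Finset.Ico (-(((1 : ℕ) : ℤ) * L')) (((1 : ℕ) : ℤ) * (L' + 1))) ×ˢ
        (Finset.univ : Finset (Fin 4)) ⊆ cubeEdges (fun _ => -(R : ℤ)) (2 * R + 1) := by
  intro e he
  have hb : (0 : ℤ) < ((1 : ℕ) : ℤ) := by norm_num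
  have hcell := (FiniteSizeCriterion.mem_cellBox_iff hb L' e).1 he
  simp only [Nat.cast_one, Int.ediv_one] at hcell
  have hR : (L' : ℤ) + 1 ≤ R := by exact_mod_cast h
  simp only [cubeEdges, Finset.mem_filter, Finset.mem_product, Finset.mem_univ, and_true, cubeSites,
    Fintype.mem_piFinset, Finset.mem_Ico, Pi.add_apply]
  refine ⟨fun j => ?_, fun j => ?_⟩
  · have hj := hcell j
    constructor <;> push_cast <;> omega
  · have hj := hcell j
    have hs : (Pi.single e.2 (1 : ℤ) : Fin 4 → ℤ) j = 0 ∨ (Pi.single e.2 (1 : ℤ) : Fin 4 → ℤ) j = 1 := by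
      rcases eq_or_ne j e.2 with h' | h'
      · subst h'; exact Or.inr (by simp)
      · exact Or.inl (by simp [Pi.single_eq_of_ne h'])
    rcases hs with hs | hs <;> rw [hs] <;> constructor <;> push_cast <;> omega

section Main

variable (G : Type) [Group G] [TopologicalSpace G] [IsTopologicalGroup G] [CompactSpace G]
  [MeasurableSpace G] [BorelSpace G] (r : LatticeRep G)

/-! ## §3 Engine core: the finite-size condition ⇒ oscillation bound on centred cubes -/

/-- **Engine core (Dobrushin–Shlosman ⇒ centred-cube oscillation).**  If the lattice Yang–Mills specification
`ymSpecification r.ρ β` satisfies the total-variation finite-size condition at window `n = 1`, cell size `b = 1` and threshold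
`ε ≥ 0` (hypothesis `hFS`, verbatim the tree's `FiniteSizeCriterion.box_influence_le` at `b = n = 1`), then for every bounded
measurable cylinder observable `A` (`|A| ≤ C_A`, support within sup-radius `R_A` of the origin) and every `k, R` with
`R_A + 3k + 1 ≤ R`, the kernel means of `A` in the centred cube `[-R, R]⁴` under ANY two exteriors differ by at most
`2 C_A (2R_A+1)⁴ (1776 ε)^k`: the block recursion bounds the influence on the Dobrushin–Shlosman box of radius `R_A + 3k`
(`box_influence_le`), the box lies inside the cube (`dsBox_subset_cubeEdges_centred`), and the oscillation over exteriors is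
antitone in the volume (`stub_influence_antitone`: consistency, Georgii Def. 1.23 (iii)). [folklore] -/
theorem osc_kerE_centred_le_of_cellFS (β : ℝ) {ε : ℝ} (hε : 0 ≤ ε)
    (hFS : ∀ w : Fin 4 → ℤ → ℤ, (∀ i j, w i j + ((1 : ℕ) : ℤ) ≤ w i (j + 1) ∧
        w i (j + 1) ≤ w i j + 2 * ((1 : ℕ) : ℤ)) →
      ∀ Y : Finset (Fin 4 → ℤ), Y ⊆ (Fintype.piFinset fun _ : Fin 4 =>
        Finset.Icc (-(2 * ((1 : ℕ) : ℤ))) (2 * ((1 : ℕ) : ℤ))) → (0 : Fin 4 → ℤ) ∈ Y →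
      ∀ η η' : LGConfig 4 G, (∀ e ∈ (Fintype.piFinset fun _ : Fin 4 =>
        Finset.Icc (-(2 * ((1 : ℕ) : ℤ))) (2 * ((1 : ℕ) : ℤ))).biUnion (fun y : Fin 4 → ℤ =>
          (Fintype.piFinset fun i : Fin 4 => Finset.Ico (w i (y i)) (w i (y i + 1))) ×ˢ
            (Finset.univ : Finset (Fin 4))), η e = η' e) →
      ∀ f : LGConfig 4 G → ℝ, IsCylinder f ((fun y : Fin 4 → ℤ =>
        (Fintype.piFinset fun i : Fin 4 => Finset.Ico (w i (y i)) (w i (y i + 1))) ×ˢ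
          (Finset.univ : Finset (Fin 4))) 0) → Measurable f → (∀ U, 0 ≤ f U ∧ f U ≤ 1) →
      |(∫ U, f U ∂(ymSpecification r.ρ β (Y.biUnion (fun y : Fin 4 → ℤ =>
          (Fintype.piFinset fun i : Fin 4 => Finset.Ico (w i (y i)) (w i (y i + 1))) ×ˢ
            (Finset.univ : Finset (Fin 4)))) η)) -
        ∫ U, f U ∂(ymSpecification r.ρ β (Y.biUnion (fun y : Fin 4 → ℤ =>
          (Fintype.piFinset fun i : Fin 4 => Finset.Ico (w i (y i)) (w i (y i + 1))) ×ˢ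
            (Finset.univ : Finset (Fin 4)))) η')| ≤ ε)
    {A : LGConfig 4 G → ℝ} (hAm : Measurable A) {CA : ℝ} (hAb : ∀ U, |A U| ≤ CA)
    {SA : Finset (Literature.MathematicalPhysics.QuantumLattice.ZdEdge 4)} (hAS : IsCylinder A SA) {RA : ℕ}
    (hRA : ∀ e ∈ SA, ∀ i, |e.1 i| ≤ RA) (k R : ℕ) (hR : RA + 3 * k + 1 ≤ R) (ζ ζ' : LGConfig 4 G) :
    |kerE G r β (fun _ => -(R : ℤ)) (2 * R + 1) ζ A - kerE G r β (fun _ => -(R : ℤ)) (2 * R + 1) ζ' A| ≤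
      2 * CA * ((2 * RA + 1) ^ 4 *
        (ε * (((2 * (2 * 1 + 1) + 1) ^ 4 - (2 * (2 * 1) + 1) ^ 4 : ℕ) : ℝ)) ^ k) := by
  haveI := r.t2Space
  haveI := r.secondCountableTopology
  -- the block recursion on the Dobrushin–Shlosman box of radius `R_A + 3k`
  have hbox := FiniteSizeCriterion.box_influence_le r.ρ r.continuous β (b := 1) (n := 1) le_rfl hε hFS k RA hAm
    hAb hAS hRA
  -- the box lies inside the centred cube; antitonicity of the oscillation in the volume
  unfold kerE
  exact stub_influence_antitone _ G (ymSpecification r.ρ β) (isSpecification_cubeKernels G r β) _ _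
    (dsBox_subset_cubeEdges_centred (L' := RA + k * (2 * 1 + 1)) (by omega)) A hAm CA hAb _
    (fun ξ ξ' => hbox ξ ξ') ζ ζ'

/-- **Centred cubes at strong coupling, every local observable.**  There is ONE `β₁ = β₁(G, r) > 0` such that for
`|β| < β₁`, every bounded measurable cylinder observable `A` (`|A| ≤ C_A`, support within sup-radius `R_A` of the origin),
every radius `R` and every pair of exteriors `ζ, ζ'`:
`|kerE_{[-R,R]⁴,ζ}(A) − kerE_{[-R,R]⁴,ζ'}(A)| ≤ 2 C_A (2R_A+1)⁴ · (1/8)^{⌊(R − R_A − 1)/3⌋}` — the strong-coupling finite-size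
condition `stub_cellFiniteSize_smallBeta` at threshold `1/14208` fed to `osc_kerE_centred_le_of_cellFS` with
`k = ⌊(R − R_A − 1)/3⌋` (radii `R ≤ R_A` by the trivial bound `2 C_A`). [folklore] -/
theorem osc_kerE_centred_le_smallBeta :
    ∃ β₁ : ℝ, 0 < β₁ ∧ ∀ β : ℝ, |β| < β₁ →
      ∀ {A : LGConfig 4 G → ℝ}, Measurable A → ∀ {CA : ℝ}, (∀ U, |A U| ≤ CA) →
      ∀ {SA : Finset (Literature.MathematicalPhysics.QuantumLattice.ZdEdge 4)}, IsCylinder A SA →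
      ∀ {RA : ℕ}, (∀ e ∈ SA, ∀ i, |e.1 i| ≤ RA) → ∀ (R : ℕ) (ζ ζ' : LGConfig 4 G),
        |kerE G r β (fun _ => -(R : ℤ)) (2 * R + 1) ζ A - kerE G r β (fun _ => -(R : ℤ)) (2 * R + 1) ζ' A| ≤
          2 * CA * (2 * RA + 1) ^ 4 * (1 / 8) ^ ((R - RA - 1) / 3) := by
  haveI := r.t2Space
  haveI := r.secondCountableTopology
  have hε : (0 : ℝ) < 1 / 14208 := by norm_num
  obtain ⟨β₁, hβ₁, hFS⟩ := stub_cellFiniteSize_smallBeta G r.N r.ρ r.continuous (1 / 14208) hε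
  refine ⟨β₁, hβ₁, fun β hβ A hAm CA hAb SA hAS RA hRA R ζ ζ' => ?_⟩
  have hCA : 0 ≤ CA := (abs_nonneg _).trans (hAb (fun _ => 1))
  have hRA1 : (1 : ℝ) ≤ (2 * RA + 1 : ℝ) ^ 4 := one_le_pow₀ (by linarith only [(Nat.cast_nonneg RA : (0 : ℝ) ≤ RA)])
  rcases lt_or_ge R (RA + 1) with hR | hR
  · -- small radius: trivial bound
    have hk : (R - RA - 1) / 3 = 0 := by omega
    rw [hk, pow_zero, mul_one]
    have h1 := abs_kerE_le G r β (fun _ => -(R : ℤ)) (2 * R + 1) ζ hAb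
    have h2 := abs_kerE_le G r β (fun _ => -(R : ℤ)) (2 * R + 1) ζ' hAb
    calc _ ≤ |kerE G r β (fun _ => -(R : ℤ)) (2 * R + 1) ζ A| + |kerE G r β (fun _ => -(R : ℤ)) (2 * R + 1) ζ' A| :=
          abs_sub _ _
      _ ≤ CA + CA := add_le_add h1 h2
      _ = 2 * CA * 1 := by ring
      _ ≤ 2 * CA * (2 * RA + 1) ^ 4 := mul_le_mul_of_nonneg_left hRA1 (by positivity)
  · -- the engine core with `k = ⌊(R − R_A − 1)/3⌋`
    have h := osc_kerE_centred_le_of_cellFS G r β hε.le (hFS β hβ) hAm hAb hAS hRA ((R - RA - 1) / 3) R (by omega) ζ ζ'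
    rw [dsRatio_eq] at h
    linarith [h]

/-! ## §4 From centred cubes to every cube, for a translation-covariant family of local fields -/

/-- **Transport to every cube.**  Let `F x` (`x ∈ ℤ⁴`) be a family of continuous local fields, bounded by `M`, whose kernel
means in the cube of radius `R` centred at `x` are those of `F 0` in `[-R, R]⁴` with the translated exterior (as `dens`,
`plane q`: `kerE_dens_centred_eq`, `kerE_plane_centred_eq`).  If the exterior-to-exterior oscillation of `F 0` on `[-R, R]⁴`
is `≤ B · (1/8)^{⌊(R − R_A − 1)/3⌋}` for every `R` (`B ≥ 2M`), then on EVERY cube `(c, b)`, for all exteriors and every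
site `x`: `|kerE_{(c,b),η}(F x) − kerE_{(c,b),η'}(F x)| ≤ B · 2^{R_A+4} · 2^{−depth}` — at depth `d ≥ 1` the centred cube of
radius `d − 1` around `x` fits (`centredCube_subset_of_le_depth`) and the oscillation is antitone
(`abs_kerE_sub_kerE_le_of_subset`); `eighth_pow_le` converts; depth `0` by the trivial bound. [folklore] -/
theorem osc_kerE_le_of_centred_family (β : ℝ) (F : (Fin 4 → ℤ) → LGConfig 4 G → ℝ)
    (hFc : ∀ x, Continuous (F x)) {M : ℝ} (hM : ∀ x U, |F x U| ≤ M)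
    (htr : ∀ (y : Fin 4 → ℤ) (R : ℕ) (U : LGConfig 4 G), kerE G r β (fun j => y j - R) (2 * R + 1) U (F y) =
      kerE G r β (fun _ => -(R : ℤ)) (2 * R + 1) (configShift (-y) U) (F 0))
    {B : ℝ} (hB : 2 * M ≤ B) (RA : ℕ)
    (hcen : ∀ (R : ℕ) (ζ ζ' : LGConfig 4 G), |kerE G r β (fun _ => -(R : ℤ)) (2 * R + 1) ζ (F 0) -
      kerE G r β (fun _ => -(R : ℤ)) (2 * R + 1) ζ' (F 0)| ≤ B * (1 / 8) ^ ((R - RA - 1) / 3))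
    (c : Fin 4 → ℤ) (b : ℕ) (η η' : LGConfig 4 G) (x : Fin 4 → ℤ) :
    |kerE G r β c b η (F x) - kerE G r β c b η' (F x)| ≤ B * 2 ^ (RA + 4) * (1 / 2) ^ depth c b x := by
  have hM0 : 0 ≤ M := (abs_nonneg _).trans (hM 0 (fun _ => 1))
  have hB0 : 0 ≤ B := by linarith
  rcases Nat.eq_zero_or_pos (depth c b x) with hd | hd
  · -- depth 0: trivial bound
    rw [hd, pow_zero, mul_one]
    have h1 := abs_kerE_le G r β c b η (hM x)
    have h2 := abs_kerE_le G r β c b η' (hM x)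
    have h16 : (1 : ℝ) ≤ 2 ^ (RA + 4) := one_le_pow₀ (by norm_num)
    calc _ ≤ |kerE G r β c b η (F x)| + |kerE G r β c b η' (F x)| := abs_sub _ _
      _ ≤ M + M := add_le_add h1 h2
      _ ≤ B * 1 := by linarith
      _ ≤ B * 2 ^ (RA + 4) := mul_le_mul_of_nonneg_left h16 hB0
  · -- the centred cube of radius `depth − 1` around `x`
    obtain ⟨R, hR⟩ : ∃ R : ℕ, depth c b x = R + 1 := ⟨depth c b x - 1, by omega⟩
    have hsub : cubeEdges (fun j => x j - R) (2 * R + 1) ⊆ cubeEdges c b :=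
      cubeEdges_subset (centredCube_subset_of_le_depth hR.ge)
    have hcenx : ∀ ζ ζ' : LGConfig 4 G, |kerE G r β (fun j => x j - R) (2 * R + 1) ζ (F x) -
        kerE G r β (fun j => x j - R) (2 * R + 1) ζ' (F x)| ≤ B * (1 / 8) ^ ((R - RA - 1) / 3) := by
      intro ζ ζ'
      rw [htr, htr]
      exact hcen R _ _
    refine (abs_kerE_sub_kerE_le_of_subset G r β hsub (hFc x) (hM x) hcenx η η').trans ?_
    have h8 := eighth_pow_le RA (R + 1)
    have hRs : (R + 1 - RA - 2) / 3 = (R - RA - 1) / 3 := by omega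
    rw [hRs] at h8
    rw [hR, mul_assoc]
    exact mul_le_mul_of_nonneg_left h8 hB0

/-- The quartic shape from the exponential one: `K · 2^{−d} ≤ (24 K / (log 2)⁴) / d⁴` for `d ≥ 1`, `K ≥ 0`. [folklore] -/
theorem exp_to_quartic {K : ℝ} (hK : 0 ≤ K) {d : ℕ} (hd : 1 ≤ d) :
    K * (1 / 2 : ℝ) ^ d ≤ K * (24 / Real.log 2 ^ 4) / (d : ℝ) ^ 4 := by
  have hlog : 0 < Real.log 2 := Real.log_pos (by norm_num)
  have hdpos : (0 : ℝ) < (d : ℝ) := by exact_mod_cast hd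
  calc K * (1 / 2 : ℝ) ^ d ≤ K * (24 / (Real.log 2 ^ 4 * (d : ℝ) ^ 4)) :=
        mul_le_mul_of_nonneg_left (half_pow_le_div_pow_four hd) hK
    _ = K * (24 / Real.log 2 ^ 4) / (d : ℝ) ^ 4 := by field_simp

/-! ## §5 The action density: E1-osc at strong coupling -/

/-- **E1-osc at strong coupling, exponential form.**  There is `β₁ = β₁(G, r) > 0` such that for `|β| < β₁`, EVERY cube
`(c, b)` of `ℤ⁴`, all exteriors `η, η'` and every site `x`:
`|kerE_{(c,b),η}(dens x) − kerE_{(c,b),η'}(dens x)| ≤ 5184 · M · 2^{−depth_{(c,b)}(x)}`, `M` any sup bound of the action density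
(`osc_kerE_centred_le_smallBeta` for `dens 0`, support radius `1`, constant `2M · 3⁴ = 162 M`; `osc_kerE_le_of_centred_family`
with `kerE_dens_centred_eq`, factor `2⁵`). [folklore] -/
theorem osc_kerE_dens_le_smallBeta {M : ℝ} (hM : ∀ (z : Fin 4 → ℤ) (U : LGConfig 4 G), |dens G r z U| ≤ M) :
    ∃ β₁ : ℝ, 0 < β₁ ∧ ∀ β : ℝ, |β| < β₁ → ∀ (c : Fin 4 → ℤ) (b : ℕ) (η η' : LGConfig 4 G) (x : Fin 4 → ℤ),
      |kerE G r β c b η (dens G r x) - kerE G r β c b η' (dens G r x)| ≤ 5184 * M * (1 / 2) ^ depth c b x := by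
  haveI := r.t2Space
  haveI := r.secondCountableTopology
  obtain ⟨β₁, hβ₁, H⟩ := osc_kerE_centred_le_smallBeta G r
  refine ⟨β₁, hβ₁, fun β hβ c b η η' x => ?_⟩
  have hM0 : 0 ≤ M := (abs_nonneg _).trans (hM 0 (fun _ => 1))
  have hRA : ∀ e ∈ (r.curvature.supp.image fun e => (e.1 + (0 : Fin 4 → ℤ), e.2)), ∀ i, |e.1 i| ≤ ((1 : ℕ) : ℤ) := by
    intro e he i
    have h := curvature_shift_supp_window r 0 e he i
    simp only [Pi.zero_apply, zero_add] at h
    rw [abs_le]; constructor <;> push_cast <;> omega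
  have hcen : ∀ (R : ℕ) (ζ ζ' : LGConfig 4 G), |kerE G r β (fun _ => -(R : ℤ)) (2 * R + 1) ζ (dens G r 0) -
      kerE G r β (fun _ => -(R : ℤ)) (2 * R + 1) ζ' (dens G r 0)| ≤ 162 * M * (1 / 8) ^ ((R - 1 - 1) / 3) := by
    intro R ζ ζ'
    have h := H β hβ (continuous_dens r 0).measurable (hM 0) (isCylinder_curvature_shift r 0) hRA R ζ ζ'
    calc _ ≤ 2 * M * (2 * ((1 : ℕ) : ℝ) + 1) ^ 4 * (1 / 8 : ℝ) ^ ((R - 1 - 1) / 3) := by exact_mod_cast h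
      _ = 162 * M * (1 / 8) ^ ((R - 1 - 1) / 3) := by push_cast; ring
  have key := osc_kerE_le_of_centred_family G r β (dens G r) (continuous_dens r) hM
    (fun y R U => kerE_dens_centred_eq G r β y R U) (B := 162 * M) (by linarith) 1 hcen c b η η' x
  calc _ ≤ 162 * M * 2 ^ (1 + 4) * (1 / 2 : ℝ) ^ depth c b x := key
    _ = 5184 * M * (1 / 2) ^ depth c b x := by norm_num; ring

/-- **E1-osc at strong coupling in the REGISTERED shape** (`RefPkgT` clause 1 of crux `NT`, skeleton v4T, with `β₁ ≤ β`
replaced by `|β| < β₁` and the femto restriction dropped): there are `β₁ > 0` and `C₁ ≥ 0` — explicitly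
`C₁ = 124416 · M / (log 2)⁴`, `M` the sup of the action density — such that for `|β| < β₁`, every cube `(c, b)`, all exteriors
`η, η'` and every site `x` of depth `≥ 1`: `|kerE_{(c,b),η}(dens x) − kerE_{(c,b),η'}(dens x)| ≤ C₁ / depth⁴`.  FORMAT RUNG:
the clause is inhabited by the lattice Yang–Mills kernels in the high-temperature regime; nothing is claimed at large `β`.
[folklore] -/
theorem e1osc_smallBeta :
    ∃ β₁ : ℝ, 0 < β₁ ∧ ∃ C₁ : ℝ, 0 ≤ C₁ ∧ ∀ β : ℝ, |β| < β₁ →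
      ∀ (c : Fin 4 → ℤ) (b : ℕ) (η η' : LGConfig 4 G) (x : Fin 4 → ℤ), 1 ≤ depth c b x →
        |kerE G r β c b η (dens G r x) - kerE G r β c b η' (dens G r x)| ≤ C₁ / (depth c b x : ℝ) ^ 4 := by
  obtain ⟨M, hM0, hM⟩ := StubLower.exists_abs_dens_le G r
  obtain ⟨β₁, hβ₁, H⟩ := osc_kerE_dens_le_smallBeta G r hM
  have hlog : 0 < Real.log 2 := Real.log_pos (by norm_num)
  exact ⟨β₁, hβ₁, 5184 * M * (24 / Real.log 2 ^ 4), by positivity, fun β hβ c b η η' x hx =>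
    (H β hβ c b η η' x).trans (exp_to_quartic (by positivity) hx)⟩

/-! ## §6 The single-plane fields: the BL6 object at strong coupling -/

/-- **BL6-osc at strong coupling, exponential form**: there is `β₁ = β₁(G, r) > 0` such that for `|β| < β₁`, every
orientation `q`, every cube, all exteriors and every site,
`|kerE_{(c,b),η}(plane q x) − kerE_{(c,b),η'}(plane q x)| ≤ 5184 · M · 2^{−depth}` (`M` any sup bound of the plaquette fields;
support of `plane q 0` = the four links of the origin plaquette, radius `1`). [folklore] -/
theorem osc_kerE_plane_le_smallBeta {M : ℝ}
    (hM : ∀ (q : Fin 4 × Fin 4) (z : Fin 4 → ℤ) (U : LGConfig 4 G), |plane G r q z U| ≤ M) :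
    ∃ β₁ : ℝ, 0 < β₁ ∧ ∀ β : ℝ, |β| < β₁ →
      ∀ (q : Fin 4 × Fin 4) (c : Fin 4 → ℤ) (b : ℕ) (η η' : LGConfig 4 G) (x : Fin 4 → ℤ),
        |kerE G r β c b η (plane G r q x) - kerE G r β c b η' (plane G r q x)| ≤ 5184 * M * (1 / 2) ^ depth c b x := by
  haveI := r.t2Space
  haveI := r.secondCountableTopology
  obtain ⟨β₁, hβ₁, H⟩ := osc_kerE_centred_le_smallBeta G r
  refine ⟨β₁, hβ₁, fun β hβ q c b η η' x => ?_⟩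
  have hM0 : 0 ≤ M := (abs_nonneg _).trans (hM q 0 (fun _ => 1))
  have hRA : ∀ e ∈ ((originPlaquetteSupport q.1 q.2).image
      fun e : Literature.MathematicalPhysics.QuantumLattice.ZdEdge 4 => (e.1 - -(0 : Fin 4 → ℤ), e.2)),
      ∀ i, |e.1 i| ≤ ((1 : ℕ) : ℤ) := by
    intro e he i
    have h := near_of_mem_supp_plane he i
    simp only [Pi.zero_apply, sub_zero] at h
    rw [abs_le]; constructor <;> push_cast <;> omega
  have hcen : ∀ (R : ℕ) (ζ ζ' : LGConfig 4 G), |kerE G r β (fun _ => -(R : ℤ)) (2 * R + 1) ζ (plane G r q 0) -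
      kerE G r β (fun _ => -(R : ℤ)) (2 * R + 1) ζ' (plane G r q 0)| ≤ 162 * M * (1 / 8) ^ ((R - 1 - 1) / 3) := by
    intro R ζ ζ'
    have h := H β hβ (continuous_plane r q 0).measurable (hM q 0) (isCylinder_plane r q 0) hRA R ζ ζ'
    calc _ ≤ 2 * M * (2 * ((1 : ℕ) : ℝ) + 1) ^ 4 * (1 / 8 : ℝ) ^ ((R - 1 - 1) / 3) := by exact_mod_cast h
      _ = 162 * M * (1 / 8) ^ ((R - 1 - 1) / 3) := by push_cast; ring
  have key := osc_kerE_le_of_centred_family G r β (plane G r q) (continuous_plane r q) (hM q)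
    (fun y R U => kerE_plane_centred_eq G r β q y R U) (B := 162 * M) (by linarith) 1 hcen c b η η' x
  calc _ ≤ 162 * M * 2 ^ (1 + 4) * (1 / 2 : ℝ) ^ depth c b x := key
    _ = 5184 * M * (1 / 2) ^ depth c b x := by norm_num; ring

/-- **BL6-osc at strong coupling in the registered `C₁/depth⁴` shape** (the body of the plane-resolved ∀-exterior one-point
law in oscillation form — the `FBL6 ⇔ E1-osc` currency of the seam's `stub_ceilings`/`stub_floorsEngine` discharge lemmas and
of `stub_fcp6` — for every orientation at once, with `|β| < β₁` in place of `β ≥ β₁`): `C₁ = 124416 · M₆ / (log 2)⁴`, `M₆` a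
sup bound of the plaquette fields.  FORMAT RUNG, nothing claimed at large `β`. [folklore] -/
theorem bl6osc_smallBeta :
    ∃ β₁ : ℝ, 0 < β₁ ∧ ∃ C₁ : ℝ, 0 ≤ C₁ ∧ ∀ β : ℝ, |β| < β₁ →
      ∀ (q : Fin 4 × Fin 4) (c : Fin 4 → ℤ) (b : ℕ) (η η' : LGConfig 4 G) (x : Fin 4 → ℤ), 1 ≤ depth c b x →
        |kerE G r β c b η (plane G r q x) - kerE G r β c b η' (plane G r q x)| ≤ C₁ / (depth c b x : ℝ) ^ 4 := by
  obtain ⟨M, hM⟩ := exists_abs_plane_le (G := G) r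
  have hMq : ∀ (q : Fin 4 × Fin 4) (z : Fin 4 → ℤ) (U : LGConfig 4 G), |plane G r q z U| ≤ max M 0 := fun q z U =>
    (hM q z U).trans (le_max_left _ _)
  obtain ⟨β₁, hβ₁, H⟩ := osc_kerE_plane_le_smallBeta G r hMq
  have hlog : 0 < Real.log 2 := Real.log_pos (by norm_num)
  have hM0 : 0 ≤ max M 0 := le_max_right _ _
  exact ⟨β₁, hβ₁, 5184 * max M 0 * (24 / Real.log 2 ^ 4), by positivity, fun β hβ q c b η η' x hx =>
    (H β hβ q c b η η' x).trans (exp_to_quartic (by positivity) hx)⟩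

end Main

end Summit.QuantumFields.YangMills.Cruxes.NT.BoundaryLaw

end
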